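import Summits.ResolutionOfSingularities.ResolutionOfSingularities.Theorems.FrobeniusLadderFInjectiveMacaulayficationFaceFPureOfMonomialPCoeff
import Summits.ResolutionOfSingularities.ResolutionOfSingularities.Theorems.FrobeniusLadderFInjectiveMacaulayficationFrobeniusPowerOfFedderAt
import Summits.ResolutionOfSingularities.ResolutionOfSingularities.Theorems.FrobeniusLadderFInjectiveMacaulayficationFedderAtMaximalIdeal
import Mathlib.FieldTheory.Finite.Polynomial
import Mathlib.RingTheory.Finiteness.Defs
import Mathlib.Algebra.CharP.Algebra
import HarnessLib

/-!
# (C6) THE CLAUSE OFF THE ORIGIN FROM FEDDER-IDEAL CERTIFICATES (`hoff` of the CN / weighted engines, any specimen)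
# (crux `FInjectiveMacaulayfication`, CN engine instantiation interface — CRUX-PLAN v7 (R7.3) «second helper
# `offOrigin_clause_of_pointFedderCertificates`»)

Support file for crux stmt-ResolutionOfSingularities-15315 (`FrobeniusLadder.FInjectiveMacaulayfication`), chain w45a,
seat res-L1-w45a-stub-3 (Q6CN typer by fallback). [OURS · L1 W4.5a] — NOT a statement of the manuscript; AI-written, weaker than
expert review.

The `hoff` hypothesis of `CNConeFiModel.cnConeFiModel` / `GradedConeFiModel` / `FilteredConeFiModel` asks for the Cohen–Macaulay +
Frobenius-closed clause of `k[X]/(f)` at every maximal ideal missing some `x̄ⱼ`. idea-2's `Q6-fan-hoff.json` delivers it as DATA: the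
`p`-split `f^(p-1) = Σ_α ψ_p(c_α)·X^α` and, for each `j`, a power `Xⱼ^N` inside the FEDDER IDEAL `(f, c_α : α)` with explicit cofactors.
This file turns such data into `hoff`, for every specimen at once:

* `expand_map_intCast` — for integer polynomials `ψ_p(c) = c^p` in characteristic `p` (so `c(b^p) = c(b)^p`; discharges `hfrob` below
  when the script writes `c_α = map (Int.castRingHom k) c₀_α`);
* `exists_aeval_ne_zero_of_certificate` — at a point `b` with `f(b) = 0` and `bⱼ ≠ 0`, a certificate `Xⱼ^N ∈ (f, c_α)` forces some
  `c_α(b) ≠ 0`;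
* `offOrigin_clause_of_pointFedderCertificates` — **`hoff` from certificates**: `f ≠ 0`, the `p`-split, `ψ_p(c_α) = c_α^p`, and for
  every `j` some `Xⱼ^N ∈ (f, c_α : α)` ⟹ the clause at every maximal `Q ∌` some `x̄ⱼ` (C5′ `fedder_of_aeval_expand_ne_zero` at the
  residue point + (C3a) `frobeniusPower_of_fedderAt` + `FedderAtMaximalIdeal.stub_fedderAtMaximalIdeal`), in EXACTLY the binder shape
  of the engines' `hoff`.

No definitions, no named facts; glue. [folklore: Fedder's criterion]
-/

-- single-problem summit: the doubled namespace component is forced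
set_option linter.dupNamespace false

noncomputable section

namespace Summit.ResolutionOfSingularities.ResolutionOfSingularities.Theorems.FInjectiveMacaulayfication.OffOriginClauseOfFedderCertificates

open Summit.ResolutionOfSingularities.ResolutionOfSingularities.Theorems.FInjectiveMacaulayfication
open Literature.RingTheory.TightClosure

/-- **Integer polynomials commute with Frobenius**: `ψ_p(c) = c^p` for `c` with integer coefficients, in characteristic `p`.
[folklore] -/
theorem expand_map_intCast (p : ℕ) [Fact p.Prime] {k : Type} [CommRing k] [CharP k p] {σ : Type}
    (c₀ : MvPolynomial σ ℤ) :
    MvPolynomial.expand p (MvPolynomial.map (Int.castRingHom k) c₀) = MvPolynomial.map (Int.castRingHom k) c₀ ^ p := by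
  have hfac : Int.castRingHom k = (ZMod.castHom (dvd_refl p) k).comp (Int.castRingHom (ZMod p)) :=
    RingHom.ext_int _ _
  rw [hfac, ← MvPolynomial.map_map, ← MvPolynomial.map_expand, MvPolynomial.expand_zmod, map_pow]

/-- **A Fedder-ideal certificate forces a non-vanishing `p`-coefficient** at every zero `b` of `f` with `bⱼ ≠ 0`. [folklore] -/
theorem exists_aeval_ne_zero_of_certificate {k : Type} [Field k] {n : ℕ} {ι : Type} (f : MvPolynomial (Fin n) k)
    (c : ι → MvPolynomial (Fin n) k) (j : Fin n) (N : ℕ)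
    (hcert : (MvPolynomial.X j : MvPolynomial (Fin n) k) ^ N ∈ Ideal.span ({f} ∪ Set.range c))
    {K : Type} [Field K] [Algebra k K] (b : Fin n → K) (hfb : MvPolynomial.aeval b f = 0) (hbj : b j ≠ 0) :
    ∃ α : ι, MvPolynomial.aeval b (c α) ≠ 0 := by
  by_contra hall
  push Not at hall
  have hle : Ideal.span ({f} ∪ Set.range c) ≤ RingHom.ker (MvPolynomial.aeval (R := k) b).toRingHom := by
    rw [Ideal.span_le]
    rintro x (hx | ⟨α, rfl⟩)
    · rw [Set.mem_singleton_iff] at hx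
      subst hx
      rw [SetLike.mem_coe, RingHom.mem_ker, AlgHom.toRingHom_eq_coe, RingHom.coe_coe]
      exact hfb
    · rw [SetLike.mem_coe, RingHom.mem_ker, AlgHom.toRingHom_eq_coe, RingHom.coe_coe]
      exact hall α
  have h1 := hle hcert
  rw [RingHom.mem_ker, AlgHom.toRingHom_eq_coe, RingHom.coe_coe, map_pow, MvPolynomial.aeval_X] at h1
  exact hbj (pow_eq_zero_iff' |>.mp h1).1

/-- **(C6) `hoff` FROM FEDDER-IDEAL CERTIFICATES.** `f ≠ 0` with the `p`-split `f^(p-1) = Σ_α ψ_p(c_α) X^α`, `ψ_p(c_α) = c_α^p`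
(integer coefficients), and for every `j` a power `Xⱼ^N ∈ (f, c_α : α)`: then `k[X]/(f)` satisfies the Cohen–Macaulay +
Frobenius-closed clause at every maximal ideal missing some `x̄ⱼ` — the `hoff` binder of the engines, verbatim. [folklore] -/
theorem offOrigin_clause_of_pointFedderCertificates (p : ℕ) [Fact p.Prime] (k : Type) [Field k] [CharP k p] (n : ℕ)
    (f : MvPolynomial (Fin n) k) (hf0 : f ≠ 0) (c : (Fin n → Fin p) → MvPolynomial (Fin n) k)
    (hF : f ^ (p - 1) = ∑ α : Fin n → Fin p, MvPolynomial.expand p (c α) *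
      MvPolynomial.monomial (Finsupp.equivFunOnFinite.symm fun j => ((α j : ℕ))) 1)
    (hfrob : ∀ α, MvPolynomial.expand p (c α) = c α ^ p)
    (hcert : ∀ j : Fin n, ∃ N : ℕ, (MvPolynomial.X j : MvPolynomial (Fin n) k) ^ N ∈ Ideal.span ({f} ∪ Set.range c)) :
    ∀ (Q : Ideal (MvPolynomial (Fin n) k ⧸ Ideal.span {f})) [Q.IsMaximal],
      (∃ j : Fin n, Ideal.Quotient.mk (Ideal.span {f}) (MvPolynomial.X j) ∉ Q) →
      ∀ d : ℕ, ringKrullDim (Localization.AtPrime Q) = d → ∀ s : Fin d → Localization.AtPrime Q,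
        (Ideal.span (Set.range s)).radical.IsMaximal →
          RingTheory.Sequence.IsWeaklyRegular (Localization.AtPrime Q) (List.ofFn s) ∧
          ∀ y : Localization.AtPrime Q, (∃ e : ℕ, y ^ p ^ e ∈ Ideal.span
            ((fun z : Localization.AtPrime Q => z ^ p ^ e) ''
              (Ideal.span (Set.range s) : Set (Localization.AtPrime Q)))) → y ∈ Ideal.span (Set.range s) := by
  intro Q _ hQ
  classical
  obtain ⟨j, hj⟩ := hQ
  -- the contraction `P`, residue field `K`, residue point `b`
  set P : Ideal (MvPolynomial (Fin n) k) := Q.comap (Ideal.Quotient.mk (Ideal.span {f})) with hP_def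
  haveI hPmax : P.IsMaximal := Ideal.comap_isMaximal_of_surjective _ Ideal.Quotient.mk_surjective
  letI : Field (MvPolynomial (Fin n) k ⧸ P) := Ideal.Quotient.field P
  have hfP : f ∈ P := by
    rw [hP_def, Ideal.mem_comap, Ideal.Quotient.eq_zero_iff_mem.mpr (Ideal.mem_span_singleton_self f)]
    exact Q.zero_mem
  have haev : ∀ q : MvPolynomial (Fin n) k,
      MvPolynomial.aeval (fun i : Fin n => Ideal.Quotient.mk P (MvPolynomial.X i)) q = Ideal.Quotient.mk P q := by
    intro q
    have h : (MvPolynomial.aeval (R := k) (fun i : Fin n => Ideal.Quotient.mk P (MvPolynomial.X i))) =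
        Ideal.Quotient.mkₐ k P := MvPolynomial.algHom_ext fun i => by
      rw [MvPolynomial.aeval_X, Ideal.Quotient.mkₐ_eq_mk]
    rw [h, Ideal.Quotient.mkₐ_eq_mk]
  have hfb : MvPolynomial.aeval (fun i : Fin n => Ideal.Quotient.mk P (MvPolynomial.X i)) f = 0 := by
    rw [haev, Ideal.Quotient.eq_zero_iff_mem]; exact hfP
  have hbj : Ideal.Quotient.mk P (MvPolynomial.X j) ≠ 0 := by
    intro h0
    apply hj
    rw [Ideal.Quotient.eq_zero_iff_mem, hP_def, Ideal.mem_comap] at h0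
    exact h0
  -- some `c_α(b) ≠ 0`, hence `ψ_p(c_α)(b) = c_α(b)^p ≠ 0`
  obtain ⟨N, hN⟩ := hcert j
  obtain ⟨α, hα⟩ := exists_aeval_ne_zero_of_certificate f c j N hN _ hfb hbj
  have hα' : MvPolynomial.aeval (fun i : Fin n => Ideal.Quotient.mk P (MvPolynomial.X i))
      (MvPolynomial.expand p (c α)) ≠ 0 := by
    rw [hfrob, map_pow]
    exact pow_ne_zero _ hα
  -- Fedder at the residue point (C5′), then `f^(p-1) ∉ P^[p]` (C3a), then the clause (Fedder at a maximal ideal)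
  have hfed := FaceFPureOfMonomialPCoeff.fedder_of_aeval_expand_ne_zero p f c hF
    (fun i : Fin n => Ideal.Quotient.mk P (MvPolynomial.X i)) ⟨α, hα'⟩
  have hfrobP := FrobeniusPowerOfFedderAt.frobeniusPower_of_fedderAt p k n f P hfed
  obtain ⟨m, gens, hgens⟩ := Submodule.fg_iff_exists_fin_generating_family.mp
    ((isNoetherianRing_iff_ideal_fg _).mp inferInstance P)
  have hfed' : f ^ (p - 1) ∉ Ideal.span (Set.range fun i : Fin m => gens i ^ p) := by
    intro h
    apply hfrobP
    refine (Ideal.span_le.mpr ?_) h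
    rintro _ ⟨i, rfl⟩
    exact pow_mem_frobeniusPower (by rw [← hgens]; exact Submodule.subset_span ⟨i, rfl⟩)
  exact FedderAtMaximalIdeal.stub_fedderAtMaximalIdeal p k n m gens f Q hgens.symm hf0 hfed'

end Summit.ResolutionOfSingularities.ResolutionOfSingularities.Theorems.FInjectiveMacaulayfication.OffOriginClauseOfFedderCertificates

end
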